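import Literature.NumberTheory.LFunctions.ThetaChainFreeCheck
import HarnessLib

/-!
# Schoenfeld's `θ`-bound on `[599, 10⁸]` by kernel computation: data-free run, chunk 7 of 35

Topic: `Literature/NumberTheory/LFunctions`. Pure proof file (a kernel computation; nothing is
asserted, no definition). The theorems below evaluate `ThetaChain.runFree` — together `150000`
data-free steps of the certified `θ`-chain (`ThetaChain.stepFree`, `ThetaChainFreeCheck.lean`: the
next prime found and certified by two gcds with the primorials of the odd primes `≤ 2999` and in
`(2999, 10007]`, the enclosures of `log p` and `θ(p)`, and the two comparisons behind
`|θ(x) − x| ≤ √x log² x/(8π)`) — from the state at the prime `23799883` to the state at the prime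
`26356711`. Soundness: `ThetaChain.runFree_sound`; assembly of the 35 chunks: `ThetaUpTo1e8.lean`.
The expected states were obtained by evaluating a twin of the same function outside the kernel
(validated bit-for-bit on the tree's chunk `ThetaChainRun.xrun14`). Declarations of `5·10⁴` steps
(about `70 s` of kernel time each; the kernel's evaluation is linear within a declaration of this size),
`decide +kernel`, standard axioms only (`maxHeartbeats 0` lifts the deterministic time-out).

## References

* L. Schoenfeld, *Sharper bounds for the Chebyshev functions θ(x) and ψ(x). II*, Math. Comp. 30
  (1976), 337–360, Thm. 10 (6.3). [Schoenfeld1976]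
* J. B. Rosser, L. Schoenfeld, *Approximate formulas for some functions of prime numbers*,
  Illinois J. Math. 6 (1962), 64–94, Thms. 18–19 (`θ`-tables to `10⁸`). [RosserSchoenfeld1962]
-/

namespace Literature.NumberTheory.LFunctions.ThetaChainRun

open ThetaChain

set_option maxHeartbeats 0 in
/-- **Data-free certified `θ`-run, chunk 7a** (steps `900001`–`950000` after `8886113`: 50000 primes,
`23799883` to `24649447`). [cite: Schoenfeld1976, Thm. 10 (6.3)] -/
theorem frun7a :
    runFree 50000
      ⟨23799883, 20533836220169118222726621, 20533836220169593860899923, 28765174891987238563176862234406, 28765174891987949780908496453365⟩ =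
    some ⟨24649447, 20576237844347374482229391, 20576237844347850121383053, 29792932128736577926648136548263, 29792932128737312926312945741907⟩ := by
  decide +kernel

set_option maxHeartbeats 0 in
/-- **Data-free certified `θ`-run, chunk 7b** (steps `950001`–`1000000` after `8886113`: 50000 primes,
`24649447` to `25503047`). [cite: Schoenfeld1976, Thm. 10 (6.3)] -/
theorem frun7b :
    runFree 50000
      ⟨24649447, 20576237844347374482229391, 20576237844347850121383053, 29792932128736577926648136548263, 29792932128737312926312945741907⟩ =
    some ⟨25503047, 20617393873085801071778448, 20617393873086276711912105, 30822776807020294421260027238508, 30822776807021053202907035268897⟩ := by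
  decide +kernel

set_option maxHeartbeats 0 in
/-- **Data-free certified `θ`-run, chunk 7c** (steps `1000001`–`1050000` after `8886113`: 50000 primes,
`25503047` to `26356711`). [cite: Schoenfeld1976, Thm. 10 (6.3)] -/
theorem frun7c :
    runFree 50000
      ⟨25503047, 20617393873085801071778448, 20617393873086276711912105, 30822776807020294421260027238508, 30822776807021053202907035268897⟩ =
    some ⟨26356711, 20657197748739381964396310, 20657197748739857605507632, 31854645322818572832177510539428, 31854645322819355395855642692862⟩ := by
  decide +kernel

end Literature.NumberTheory.LFunctions.ThetaChainRun
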